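import Summits.HodgeConjecture.CorCM.IrreducibleOddWeightsIsotypicParity
import Summits.HodgeConjecture.CorCM.IrreducibleOddWeightsShadowModulesCMFields
import HarnessLib

/-!
# Isotypic cells, existence X: NONDEGENERACY CLASS BY CLASS — a CM type is nondegenerate iff in every ODD isotypic
# class its components are free over the commutant: `rank Φ = |E|/2 + 1 ⟺ ∀ c odd, dim D_c⟨b_c⟩ = m_c·δ_c`

COR-CM (cell `pub-hodgecm2`, binder seat `b16` gen 76, count-neutral claim THE ISOTYPIC DECOMPOSITION EXISTS, file
E10 — type ranks and the CM dress; theorems only, no definition, no named fact, no `sorry`).  NEW as stated, hence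
under `Summits/`.  HONEST FRAMING: a NONDEGENERATE CM type `Φ ⊆ E` has `rank Φ = |E|/2 + 1` (`dim Hg(A_Φ) =
dim A_Φ`; tree `typeRank_le`, `IsNondegenerate`).  With an isotypic decomposition of the type vector
`u = Σ_c Σ_j ι_{c,j}(b_{c,j})` over pairwise non-embeddable references `A_c` (multiplicities `m_c = |J_c|`, commutants
`𝒟_c`, `δ_c = dim 𝒟_c·a₀_c`), gen 75 M5 gives `rank Φ − 1 = Σ_c r_c·dim A_c` with `dim D_c⟨b_c⟩ = r_c·δ_c`,
`r_c ≤ m_c`; file E9 gives `r_c = 0` for EVEN classes and `|E|/2 = dim Anti = Σ_{c odd} m_c·dim A_c`.  Comparing term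
by term: **`Φ` is nondegenerate iff `r_c = m_c` for every ODD class `c`**, i.e. iff the components
`b_{c,1}, …, b_{c,m_c}` are `𝒟_c`-FREE (their D-span has the maximal dimension `m_c·δ_c`).  This is Kubota's / Mai's
criterion («`π(τ)` invertible for every odd irreducible `π`», tree gen 57 `…MultiplicityCriterion`) in the
reference-irreducible currency of gen 72–75, for arbitrary (non-Galois) CM fields and families.  Nothing about Hodge
classes is asserted; `HC_CM` is neither used nor asserted.

* §1 `iSup_map_applyₗ_eq_bot_of_forall_eq_zero` (zero components have zero D-span — so the `r_c` of an even class
  vanishes).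
* §2 **THE CRITERION FOR ONE MEMBER OF A FAMILY** (`typeRank_eq_iff_forall_odd_finrank_eq`): with an isotypic
  decomposition of the type vectors whose images span the slot `E_{i₀}`,
  **`rank Φ_{i₀} = |E_{i₀}|/2 + 1 ⟺ ∀ c` with `A_c` odd, `dim ⨆_j 𝒟_c·b^{i₀}_{c,j} = |J_{i₀,c}|·δ_c`**.
* §3 WITH NO INPUT BUT THE TYPES (`exists_isotypic_typeRank_eq_iff_forall_odd`): for every family of CM types there is
  an isotypic decomposition of the type vectors for which the criterion of §2 holds for EVERY member.
* §4 CM FIELDS (`exists_isotypic_isNondegenerate_iff_forall_odd`): **`A_{Φ_i}` is nondegenerate (`IsNondegenerate Φ_i`)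
  iff in every odd class the components of `u_i` are `𝒟_c`-free**, for all `i` at once.

## References

* [Kubota1965] T. Kubota, *On the field extension by complex multiplication*, Trans. AMS 118 (1965), §2 Lemma 2 and
  the criterion p. 115.
* [Mai1989] L. Mai, *Lower bounds for the ranks of CM types*, J. Number Theory 32 (1989), §2 Prop. 1 and the
  criterion following it.
* [Dodson1987] B. Dodson, *On the Mumford–Tate group of an abelian variety with complex multiplication*, J. Algebra
  111 (1987), §1.1 (rank and nondegeneracy of a CM type).
* [Deligne1982HodgeCycles] P. Deligne, *Hodge cycles on abelian varieties*, LNM 900 (1982), I Ex. 3.7.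
-/

set_option autoImplicit false

noncomputable section

open scoped BigOperators Classical

universe u uC uJ v vC w

namespace Summit.HodgeConjecture.CorCM.IrrOdd

open Literature.NumberTheory.ComplexMultiplication

variable {G : Type w} [Group G] {ρ : G}

/-! ### §1 Even classes carry no rank -/

section Even

variable {Y : Type vC} [MulAction G Y]

omit [Group G] [MulAction G Y] in
/-- Zero components have zero D-span: `⨆_j 𝒟·0 = 0`. [folklore] -/
theorem iSup_map_applyₗ_eq_bot_of_forall_eq_zero {J : Type uJ}
    (𝒟 : Submodule ℚ ((Y → ℚ) →ₗ[ℚ] (Y → ℚ))) {b : J → (Y → ℚ)} (hb : ∀ j, b j = 0) :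
    (⨆ j, 𝒟.map (LinearMap.applyₗ (b j))) = ⊥ := by
  rw [eq_bot_iff]
  refine iSup_le fun j => Submodule.map_le_iff_le_comap.2 fun L _ => ?_
  rw [Submodule.mem_comap, LinearMap.applyₗ_apply_apply, hb j, map_zero]
  exact Submodule.zero_mem _

end Even

/-! ### §2 The criterion for one member of a family -/

section Family

variable {I : Type u} {E : I → Type v} [∀ i, MulAction G (E i)] [∀ i, Fintype (E i)] [Fintype I]
  [∀ i, Nonempty (E i)]
  {C : Type uC} [Fintype C] {Yc : C → Type vC} [∀ c, MulAction G (Yc c)] [∀ c, Fintype (Yc c)]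
  {Ar : ∀ c, Submodule ℚ (Yc c → ℚ)} {𝒟 : ∀ c, Submodule ℚ ((Yc c → ℚ) →ₗ[ℚ] (Yc c → ℚ))}
  {JJ : I → C → Type uJ} [∀ i c, Fintype (JJ i c)]

omit [Fintype I] in
/-- **NONDEGENERACY CLASS BY CLASS (one member of a family).**  CM types `Φ_i ⊆ E_i` for `ρ`, the type vectors
decomposed over pairwise non-embeddable references `A_c ≤ ℚ^{Y_c}` (`ρ` commuting with the action and involutive on
every `Y_c`), commutants `𝒟_c`, embeddings `ι^i_{c,j}` equivariant and jointly independent on `A_c`, components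
`b^i_{c,j} ∈ A_c`, non-zero `a₀_c ∈ A_c`; the images `ι^{i₀}_{c,j}(A_c)` span `ℚ^{E_{i₀}}`.  Then
**`rank Φ_{i₀} = |E_{i₀}|/2 + 1 ⟺` for every class `c` with `A_c` ODD, `dim ⨆_j 𝒟_c·b^{i₀}_{c,j} = |J_{i₀,c}|·dim 𝒟_c·a₀_c`**
(the components of the odd classes are `𝒟_c`-free).  Even classes carry no component (E9), `rank − 1 = Σ_c r_c·dim A_c`
(gen 75 M5), `|E|/2 = dim Anti = Σ_{c odd} m_c·dim A_c` (E9), `r_c ≤ m_c`. [cite: Kubota1965, §2 (p. 115)]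
[cite: Mai1989, §2 Prop. 1] [cite: Deligne1982HodgeCycles, I Ex. 3.7] -/
theorem typeRank_eq_iff_forall_odd_finrank_eq {Φ : ∀ i, Set (E i)} (h : ∀ i, IsCMTypeWith ρ (Φ i)) (i₀ : I)
    (hcomm : ∀ c (g : G) (y : Yc c), g • ρ • y = ρ • g • y) (hinv : ∀ c (y : Yc c), ρ • ρ • y = y)
    (h𝒟 : ∀ c (L : (Yc c → ℚ) →ₗ[ℚ] (Yc c → ℚ)), L ∈ 𝒟 c ↔ (∀ a ∈ Ar c, L a ∈ Ar c) ∧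
      ∀ (k : G) (a : Yc c → ℚ), a ∈ Ar c → L (fun y => a (k • y)) = fun y => L a (k • y))
    (hRst : ∀ c (k : G) (a : Yc c → ℚ), a ∈ Ar c → (fun y => a (k • y)) ∈ Ar c)
    (hRirr : ∀ c (W : Submodule ℚ (Yc c → ℚ)), W ≤ Ar c → W ≠ ⊥ →
      (∀ (k : G) (f : Yc c → ℚ), f ∈ W → (fun y => f (k • y)) ∈ W) → W = Ar c)
    (hsep : ∀ c c' (L : (Yc c → ℚ) →ₗ[ℚ] (Yc c' → ℚ)), c ≠ c' → Ar c ≠ ⊥ → (∀ a ∈ Ar c, L a ∈ Ar c') →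
      (∀ a ∈ Ar c, L a = 0 → a = 0) →
      (∀ (k : G) (a : Yc c → ℚ), a ∈ Ar c → L (fun y => a (k • y)) = fun y => L a (k • y)) → False)
    (ι : ∀ i c, JJ i c → ((Yc c → ℚ) →ₗ[ℚ] (E i → ℚ)))
    (hιeq : ∀ i c (j : JJ i c) (k : G) (a : Yc c → ℚ), a ∈ Ar c →
      ι i c j (fun y => a (k • y)) = fun y => ι i c j a (k • y))
    (hind : ∀ i c (f : JJ i c → (Yc c → ℚ)), (∀ j, f j ∈ Ar c) → ∑ j, ι i c j (f j) = 0 → ∀ j, f j = 0)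
    {b : ∀ i c, JJ i c → (Yc c → ℚ)} (hb : ∀ i c j, b i c j ∈ Ar c)
    (hu : ∀ i, antiVec (Φ i) (1 : G) = ∑ c, ∑ j, ι i c j (b i c j))
    {a₀ : ∀ c, Yc c → ℚ} (ha₀ : ∀ c, a₀ c ∈ Ar c) (h0 : ∀ c, a₀ c ≠ 0)
    (htop : (⨆ c, ⨆ j, (Ar c).map (ι i₀ c j)) = ⊤) :
    typeRank G (Φ i₀) = Fintype.card (E i₀) / 2 + 1 ↔
      ∀ c, Ar c ≤ antiWeights (E := Yc c) ρ →
        Module.finrank ℚ ↥(⨆ j, (𝒟 c).map (LinearMap.applyₗ (b i₀ c j))) =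
          Fintype.card (JJ i₀ c) * Module.finrank ℚ ↥((𝒟 c).map (LinearMap.applyₗ (a₀ c))) := by
  obtain ⟨r, hr, hD, hS⟩ := exists_rank_typeRank_eq_sum_of_classes h i₀ h𝒟 hRst hRirr hsep ι hιeq hind hb hu ha₀ h0
  -- `δ_c > 0`, `d_c > 0`
  have hδ : ∀ c, 0 < Module.finrank ℚ ↥((𝒟 c).map (LinearMap.applyₗ (a₀ c))) := by
    intro c
    refine Module.finrank_pos_iff_exists_ne_zero.2 ⟨⟨a₀ c, ?_⟩, fun h1 => h0 c (congrArg Subtype.val h1)⟩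
    exact Submodule.mem_map.2 ⟨LinearMap.id, (h𝒟 c _).2 ⟨fun a ha => ha, fun k a _ => rfl⟩, rfl⟩
  have hd : ∀ c, 0 < Module.finrank ℚ (Ar c) := fun c =>
    Module.finrank_pos_iff_exists_ne_zero.2 ⟨⟨a₀ c, ha₀ c⟩, fun h1 => h0 c (congrArg Subtype.val h1)⟩
  -- the type vector is odd; even classes carry no rank
  have hodd : (∑ c, ∑ j, ι i₀ c j (b i₀ c j)) ∈ antiWeights (E := E i₀) ρ := by
    rw [← hu i₀]
    exact antiVec_mem_antiWeights (h i₀) 1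
  have hr0 : ∀ c, ¬ Ar c ≤ antiWeights (E := Yc c) ρ → r c = 0 := by
    intro c hc
    have heven : Ar c ≤ symWeights (E := Yc c) ρ :=
      (le_symWeights_or_le_antiWeights (hcomm c) (hinv c) (hRst c) (hRirr c)).resolve_right hc
    have hb0 : ∀ j, b i₀ c j = 0 :=
      eq_zero_of_le_symWeights hRst hRirr hsep (ι i₀) (hιeq i₀) (hind i₀) (hb i₀) hodd heven
    have h1 := hD c
    rw [iSup_map_applyₗ_eq_bot_of_forall_eq_zero (𝒟 c) hb0, finrank_bot] at h1
    exact (Nat.mul_eq_zero.1 h1.symm).resolve_right (hδ c).ne'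
  -- `|E_{i₀}|/2 = dim Anti = Σ_c (m_c·d_c if odd else 0)`
  have hhalf : Module.finrank ℚ (antiWeights (E := E i₀) ρ) = Fintype.card (E i₀) / 2 := by
    have h1 := card_le_two_mul_finrank_antiWeights (h i₀)
    have h2 := Shadow.finrank_antiWeights_le (h i₀)
    omega
  have hanti : Fintype.card (E i₀) / 2 =
      ∑ c, (if Ar c ≤ antiWeights (E := Yc c) ρ then
        Fintype.card (JJ i₀ c) * Module.finrank ℚ (Ar c) else 0) := by
    rw [← hhalf, finrank_antiWeights_eq_sum_odd hcomm hinv hRst hRirr hsep (ι i₀) (hιeq i₀) (hind i₀) htop,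
      ← Finset.sum_filter, Finset.sum_subtype (Finset.univ.filter fun c => Ar c ≤ antiWeights (E := Yc c) ρ)
        (fun c => by rw [Finset.mem_filter, and_iff_right (Finset.mem_univ c)])]
  -- term-by-term comparison
  have hle : ∀ c ∈ (Finset.univ : Finset C), r c * Module.finrank ℚ (Ar c) ≤
      (if Ar c ≤ antiWeights (E := Yc c) ρ then Fintype.card (JJ i₀ c) * Module.finrank ℚ (Ar c) else 0) := by
    intro c _
    by_cases hc : Ar c ≤ antiWeights (E := Yc c) ρ
    · rw [if_pos hc]
      exact Nat.mul_le_mul_right _ (hr c)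
    · rw [if_neg hc, hr0 c hc, zero_mul]
  rw [hS, hanti]
  constructor
  · intro heq c hc
    have h1 := (Finset.sum_eq_sum_iff_of_le hle).1 (Nat.add_right_cancel heq) c (Finset.mem_univ c)
    rw [if_pos hc] at h1
    rw [hD c, Nat.eq_of_mul_eq_mul_right (hd c) h1]
  · intro hfree
    congr 1
    refine (Finset.sum_eq_sum_iff_of_le hle).2 fun c _ => ?_
    by_cases hc : Ar c ≤ antiWeights (E := Yc c) ρ
    · rw [if_pos hc]
      have h1 := hfree c hc
      rw [hD c] at h1
      rw [Nat.eq_of_mul_eq_mul_right (hδ c) h1]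
    · rw [if_neg hc, hr0 c hc, zero_mul]

end Family

/-! ### §3 With no input but the types -/

section NoInput

variable {I : Type u} {E : I → Type v} [∀ i, MulAction G (E i)] [∀ i, Fintype (E i)] [Fintype I]
  [∀ i, Nonempty (E i)]

/-- **NONDEGENERACY CLASS BY CLASS, WITH NO INPUT BUT THE TYPES.**  For every family of CM types `Φ_i ⊆ E_i` there is
an isotypic decomposition of the type vectors (references `A_c ≤ ℚ^{⊔_i E_i}` stable irreducible non-zero pairwise
non-embeddable, commutants `𝒟_c`, multiplicities `m_{i,c}`, equivariant jointly independent embeddings, components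
`b^i_{c,j} ∈ A_c` with `u_i = Σ ι(b)`, non-zero `a₀_c ∈ A_c`) such that, for EVERY member,
**`rank Φ_i = |E_i|/2 + 1 ⟺ ∀ c` with `A_c` odd, `dim ⨆_j 𝒟_c·b^i_{c,j} = m_{i,c}·dim 𝒟_c·a₀_c`** (E3 + §2).
[cite: Kubota1965, §2 (p. 115)] [cite: Mai1989, §2 Prop. 1] -/
theorem exists_isotypic_typeRank_eq_iff_forall_odd {Φ : ∀ i, Set (E i)} (h : ∀ i, IsCMTypeWith ρ (Φ i)) :
    ∃ (n : ℕ) (Ar : Fin n → Submodule ℚ ((Σ i, E i) → ℚ))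
      (𝒟 : Fin n → Submodule ℚ (((Σ i, E i) → ℚ) →ₗ[ℚ] ((Σ i, E i) → ℚ))) (m : I → Fin n → ℕ)
      (ι : ∀ (i : I) (c : Fin n), Fin (m i c) → (((Σ i, E i) → ℚ) →ₗ[ℚ] (E i → ℚ)))
      (b : ∀ (i : I) (c : Fin n), Fin (m i c) → ((Σ i, E i) → ℚ)) (a₀ : Fin n → ((Σ i, E i) → ℚ)),
      (∀ (c : Fin n) (L : ((Σ i, E i) → ℚ) →ₗ[ℚ] ((Σ i, E i) → ℚ)), L ∈ 𝒟 c ↔ (∀ a ∈ Ar c, L a ∈ Ar c) ∧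
        ∀ (k : G) (a : (Σ i, E i) → ℚ), a ∈ Ar c → L (fun x => a (k • x)) = fun x => L a (k • x)) ∧
      (∀ (c : Fin n) (k : G) (a : (Σ i, E i) → ℚ), a ∈ Ar c → (fun x => a (k • x)) ∈ Ar c) ∧
      (∀ (c : Fin n) (W : Submodule ℚ ((Σ i, E i) → ℚ)), W ≤ Ar c → W ≠ ⊥ →
        (∀ (k : G) (f : (Σ i, E i) → ℚ), f ∈ W → (fun x => f (k • x)) ∈ W) → W = Ar c) ∧
      (∀ c : Fin n, Ar c ≠ ⊥) ∧
      (∀ (c c' : Fin n) (L : ((Σ i, E i) → ℚ) →ₗ[ℚ] ((Σ i, E i) → ℚ)), c ≠ c' → Ar c ≠ ⊥ →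
        (∀ a ∈ Ar c, L a ∈ Ar c') → (∀ a ∈ Ar c, L a = 0 → a = 0) →
        (∀ (k : G) (a : (Σ i, E i) → ℚ), a ∈ Ar c → L (fun x => a (k • x)) = fun x => L a (k • x)) →
        False) ∧
      (∀ (i : I) (c : Fin n) (j : Fin (m i c)) (k : G) (a : (Σ i, E i) → ℚ), a ∈ Ar c →
        ι i c j (fun x => a (k • x)) = fun s => ι i c j a (k • s)) ∧
      (∀ (i : I) (c : Fin n) (f : Fin (m i c) → ((Σ i, E i) → ℚ)), (∀ j, f j ∈ Ar c) →
        ∑ j, ι i c j (f j) = 0 → ∀ j, f j = 0) ∧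
      (∀ i c j, b i c j ∈ Ar c) ∧ (∀ i, antiVec (Φ i) (1 : G) = ∑ c, ∑ j, ι i c j (b i c j)) ∧
      (∀ c, a₀ c ∈ Ar c) ∧ (∀ c, a₀ c ≠ 0) ∧
      ∀ i, (typeRank G (Φ i) = Fintype.card (E i) / 2 + 1 ↔
        ∀ c, Ar c ≤ antiWeights (E := Σ i, E i) ρ →
          Module.finrank ℚ ↥(⨆ j, (𝒟 c).map (LinearMap.applyₗ (b i c j))) =
            m i c * Module.finrank ℚ ↥((𝒟 c).map (LinearMap.applyₗ (a₀ c)))) := by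
  obtain ⟨n, Ar, m, ι, hRst, hRirr, hR0, hsep, hιeq, hind, -, htop, hdec⟩ :=
    exists_isotypic_decomposition (G := G) (E := E)
  obtain ⟨𝒟, h𝒟⟩ := exists_commutants (G := G) Ar
  obtain ⟨a₀, ha₀, h0⟩ := exists_mem_ne_zero_of_forall_ne_bot hR0
  obtain ⟨b, hb, hu⟩ := hdec fun i => antiVec (Φ i) (1 : G)
  -- `ρ` commutes with the slotwise action and is involutive on `⊔_i E_i`
  have hcomm : ∀ (g : G) (y : Σ i, E i), g • ρ • y = ρ • g • y := by
    rintro g ⟨i, s⟩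
    change (⟨i, g • ρ • s⟩ : Σ i, E i) = ⟨i, ρ • g • s⟩
    rw [(h i).comm g s]
  have hinv : ∀ y : Σ i, E i, ρ • ρ • y = y := by
    rintro ⟨i, s⟩
    change (⟨i, ρ • ρ • s⟩ : Σ i, E i) = ⟨i, s⟩
    rw [(h i).invol s]
  refine ⟨n, Ar, 𝒟, m, ι, b, a₀, h𝒟, hRst, hRirr, hR0, hsep, hιeq, hind, hb, hu, ha₀, h0, fun i => ?_⟩
  have h1 := typeRank_eq_iff_forall_odd_finrank_eq (Yc := fun _ : Fin n => Σ i, E i)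
    (JJ := fun i c => Fin (m i c)) h i (fun _ => hcomm) (fun _ => hinv) h𝒟 hRst hRirr hsep ι hιeq hind hb hu
    ha₀ h0 (htop i)
  simp only [Fintype.card_fin] at h1
  exact h1

end NoInput

end Summit.HodgeConjecture.CorCM.IrrOdd

/-! ### §4 CM fields -/

namespace Summit.HodgeConjecture.CorCM

open CategoryTheory CategoryTheory.Limits NumberField Module IntermediateField
open Literature.NumberTheory.ComplexMultiplication
open Literature.AlgebraicGeometry.Motives (AbelianVariety CMType)
open Literature.AlgebraicGeometry.Motives.AbelianVariety
open Literature.AlgebraicGeometry.HodgeTheory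
open Literature.AlgebraicGeometry.ComplexMultiplication (IsCMTypeRealisation)
open Literature.AlgebraicGeometry.Pohlmann1968

variable {I : Type} [Fintype I] {K : I → Type} [∀ i, Field (K i)] [∀ i, NumberField (K i)] [∀ i, IsCMField (K i)]

/-- **NONDEGENERACY OF CM ABELIAN VARIETIES CLASS BY CLASS, WITH NO INPUT BUT THE CM TYPES.**  For CM fields `K_i`
and CM types `Φ_i` there is an isotypic decomposition of the type vectors over pairwise non-embeddable
`Aut(ℂ)`-stable irreducibles `A_c ≤ ℚ^{⊔_i Hom(K_i, ℂ)}` (commutants `𝒟_c`, multiplicities `m_{i,c}`, components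
`b^i_{c,j}`, non-zero `a₀_c ∈ A_c`) such that for EVERY `i`: **`A_{Φ_i}` is NONDEGENERATE (`IsNondegenerate Φ_i`:
`dim Hg(A_{Φ_i}) = dim A_{Φ_i}`) iff for every class `c` with `A_c` ODD under complex conjugation the components
`b^i_{c,1}, …, b^i_{c,m_{i,c}}` are `𝒟_c`-free: `dim ⨆_j 𝒟_c·b^i_{c,j} = m_{i,c}·dim 𝒟_c·a₀_c`**.
[cite: Kubota1965, §2 Lemma 2 and p. 115] [cite: Mai1989, §2 Prop. 1] [cite: Dodson1987, §1.1 (p. 51)] -/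
theorem exists_isotypic_isNondegenerate_iff_forall_odd (Φ : ∀ i, CMType (K i)) :
    ∃ (n : ℕ) (Ar : Fin n → Submodule ℚ ((Σ i, (K i →+* ℂ)) → ℚ))
      (𝒟 : Fin n → Submodule ℚ (((Σ i, (K i →+* ℂ)) → ℚ) →ₗ[ℚ] ((Σ i, (K i →+* ℂ)) → ℚ)))
      (m : I → Fin n → ℕ)
      (ι : ∀ (i : I) (c : Fin n), Fin (m i c) → (((Σ i, (K i →+* ℂ)) → ℚ) →ₗ[ℚ] ((K i →+* ℂ) → ℚ)))
      (b : ∀ (i : I) (c : Fin n), Fin (m i c) → ((Σ i, (K i →+* ℂ)) → ℚ))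
      (a₀ : Fin n → ((Σ i, (K i →+* ℂ)) → ℚ)),
      (∀ (c : Fin n) (L : ((Σ i, (K i →+* ℂ)) → ℚ) →ₗ[ℚ] ((Σ i, (K i →+* ℂ)) → ℚ)), L ∈ 𝒟 c ↔
        (∀ a ∈ Ar c, L a ∈ Ar c) ∧ ∀ (k : ℂ ≃+* ℂ) (a : (Σ i, (K i →+* ℂ)) → ℚ), a ∈ Ar c →
          L (fun x => a (k • x)) = fun x => L a (k • x)) ∧
      (∀ (c : Fin n) (k : ℂ ≃+* ℂ) (a : (Σ i, (K i →+* ℂ)) → ℚ), a ∈ Ar c → (fun x => a (k • x)) ∈ Ar c) ∧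
      (∀ (c : Fin n) (W : Submodule ℚ ((Σ i, (K i →+* ℂ)) → ℚ)), W ≤ Ar c → W ≠ ⊥ →
        (∀ (k : ℂ ≃+* ℂ) (f : (Σ i, (K i →+* ℂ)) → ℚ), f ∈ W → (fun x => f (k • x)) ∈ W) → W = Ar c) ∧
      (∀ c : Fin n, Ar c ≠ ⊥) ∧
      (∀ (c c' : Fin n) (L : ((Σ i, (K i →+* ℂ)) → ℚ) →ₗ[ℚ] ((Σ i, (K i →+* ℂ)) → ℚ)), c ≠ c' → Ar c ≠ ⊥ →
        (∀ a ∈ Ar c, L a ∈ Ar c') → (∀ a ∈ Ar c, L a = 0 → a = 0) →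
        (∀ (k : ℂ ≃+* ℂ) (a : (Σ i, (K i →+* ℂ)) → ℚ), a ∈ Ar c →
          L (fun x => a (k • x)) = fun x => L a (k • x)) → False) ∧
      (∀ (i : I) (c : Fin n) (j : Fin (m i c)) (k : ℂ ≃+* ℂ) (a : (Σ i, (K i →+* ℂ)) → ℚ), a ∈ Ar c →
        ι i c j (fun x => a (k • x)) = fun s => ι i c j a (k • s)) ∧
      (∀ (i : I) (c : Fin n) (f : Fin (m i c) → ((Σ i, (K i →+* ℂ)) → ℚ)), (∀ j, f j ∈ Ar c) →
        ∑ j, ι i c j (f j) = 0 → ∀ j, f j = 0) ∧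
      (∀ i c j, b i c j ∈ Ar c) ∧
      (∀ i, antiVec (Φ i).1 (1 : ℂ ≃+* ℂ) = ∑ c, ∑ j, ι i c j (b i c j)) ∧
      (∀ c, a₀ c ∈ Ar c) ∧ (∀ c, a₀ c ≠ 0) ∧
      ∀ i, (IsNondegenerate (Φ i) ↔
        ∀ c, Ar c ≤ antiWeights (E := Σ i, (K i →+* ℂ)) (starRingAut : ℂ ≃+* ℂ) →
          Module.finrank ℚ ↥(⨆ j, (𝒟 c).map (LinearMap.applyₗ (b i c j))) =
            m i c * Module.finrank ℚ ↥((𝒟 c).map (LinearMap.applyₗ (a₀ c)))) := by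
  haveI : ∀ i, Nonempty (K i →+* ℂ) := fun i => inferInstance
  obtain ⟨n, Ar, 𝒟, m, ι, b, a₀, h𝒟, hRst, hRirr, hR0, hsep, hιeq, hind, hb, hu, ha₀, h0, hcrit⟩ :=
    IrrOdd.exists_isotypic_typeRank_eq_iff_forall_odd (G := ℂ ≃+* ℂ) (E := fun i => K i →+* ℂ)
      (Φ := fun i => (Φ i).1) fun i => isCMTypeWith_conj (Φ i)
  refine ⟨n, Ar, 𝒟, m, ι, b, a₀, h𝒟, hRst, hRirr, hR0, hsep, hιeq, hind, hb, hu, ha₀, h0, fun i => ?_⟩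
  rw [isNondegenerate_iff, ← NumberField.Embeddings.card (K i) ℂ]
  exact hcrit i

end Summit.HodgeConjecture.CorCM

end
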